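import Literature.AlgebraicGeometry.Resolution.RegularLocalRingsQuotient
import Mathlib.RingTheory.RegularLocalRing.Polynomial
import Mathlib.RingTheory.KrullDimension.Regular
import Mathlib.RingTheory.MvPolynomial.Ideal
import Mathlib.RingTheory.Localization.AtPrime.Basic
import HarnessLib

/-!
# The suspension `yz + f = 0` is singular at the origin when `f ∈ (x)²`
(crux `FrobeniusLadder.FRationalResolution`, line `Sketch`)

Stub `stub_suspension_not_regular` (worker W7) of the skeleton `Sketch` for crux
stmt-ResolutionOfSingularities-15317: the ring-level half of the "suspension calibration" (the lead
lifts it to the scheme `Spec k[y, z, x₁..xₙ]/(yz + f)`). Let `k` be a field,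
`S = k[y, z, x₁, …, xₙ] = MvPolynomial (Fin 2 ⊕ Fin n) k`, `M₀ = (all variables)` the origin and
`g = yz + f` with `f ∈ (x₁, …, xₙ)²`, `f ≠ 0`.

* `spanFinrank_maximalIdeal_le_spanFinrank_map_of_le_sq` — NAKAYAMA: for a Noetherian local ring
  `(R, 𝔪)` and an ideal `I ⊆ 𝔪²`, the embedding dimension does not drop in `R/I`:
  `μ(𝔪) ≤ μ(𝔪 · R/I)` (lift a minimal basis `t̄` of `𝔪/I`; then `𝔪 = (t) + I ⊆ (t) + 𝔪²`, so
  `𝔪 = (t)`).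
* `not_isRegularLocalRing_quotient_of_mem_sq` — THE ABSTRACT CORE: a regular local ring `(T, 𝔪)`
  modulo a non-zero `x ∈ 𝔪²` is never regular: `T` is a domain (Matsumura 14.3,
  `isDomain_of_isRegularLocalRing`), so `dim T/(x) + 1 = dim T = μ(𝔪)`
  (`ringKrullDim_quotient_span_singleton_succ_eq_ringKrullDim_of_mem_nonZeroDivisors`), while
  `μ(𝔪/(x)) ≥ μ(𝔪)` by the Nakayama step; regularity of `T/(x)` would give
  `μ(𝔪) ≤ μ(𝔪/(x)) = dim T/(x) < dim T = μ(𝔪)`.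
* `span_range_X_eq_ker_constantCoeff`, `isMaximal_span_range_X` — the origin `M₀ = (Xᵢ)ᵢ` of a
  polynomial ring over a field is the kernel of the constant-coefficient map, a maximal ideal
  (adapted from `Fedder.span_range_X_eq_ker` of the stmt-15315 line to an arbitrary index type).
* `suspension_mem_sq`, `suspension_ne_zero` — `g = yz + f ∈ M₀²` (as `f ∈ (x)²` and renaming the
  variables maps `(x)` into `M₀`) and `g ≠ 0` (evaluate at `y = z = 1`, `x = 0`).
* `stub_suspension_not_regular` — the registered stub: `M₀` is maximal, `g ∈ M₀`, and
  `S_{M₀}/(g)` is NOT a regular local ring (`S_{M₀}` is regular local by Mathlib's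
  `IsRegularRing (MvPolynomial _ k)` instance, `g ↦ g' ∈ 𝔪² ∖ {0}` since `𝔪 = M₀ S_{M₀}` and
  `S → S_{M₀}` is injective; apply the abstract core).

References: H. Matsumura, *Commutative Ring Theory*, CUP 1986, Thm. 14.2–14.3 and §14 Remark
(a regular local ring modulo an element of `𝔪²` is not regular: the embedding dimension is
unchanged while the dimension drops).
-/

-- single-problem summit: the doubled namespace component is forced
set_option linter.dupNamespace false

namespace Summit.ResolutionOfSingularities.ResolutionOfSingularities.Theorems.FRationalResolution

open IsLocalRing MvPolynomial Literature.AlgebraicGeometry.Resolution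

section AbstractCore

variable {R : Type*} [CommRing R]

/-- **Nakayama: the embedding dimension does not drop modulo an ideal inside `𝔪²`.** For a
Noetherian local ring `(R, 𝔪)` and an ideal `I ⊆ 𝔪²`:
`μ(𝔪) ≤ μ(𝔪 · (R/I))`. Lift a minimal generating set `t̄` of `𝔪(R/I)` to `t ⊆ 𝔪`; then
`𝔪 = (t) + I ⊆ (t) + 𝔪·𝔪`, so `𝔪 = (t)` by Nakayama and `μ(𝔪) ≤ |t| = μ(𝔪(R/I))`.
[cite: Matsumura1987, Thm. 14.2] (Remark after the proof.) -/
theorem spanFinrank_maximalIdeal_le_spanFinrank_map_of_le_sq [IsLocalRing R] [IsNoetherianRing R]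
    {I : Ideal R} (hI : I ≤ (maximalIdeal R) ^ 2) :
    (maximalIdeal R).spanFinrank ≤ ((maximalIdeal R).map (Ideal.Quotient.mk I)).spanFinrank := by
  classical
  set m := maximalIdeal R with hm
  have hIm : I ≤ m := hI.trans (Ideal.pow_le_self two_ne_zero)
  have fg : (m.map (Ideal.Quotient.mk I)).FG := (isNoetherian_def.mp inferInstance) _
  obtain ⟨t, htcard, htspan⟩ := Submodule.FG.exists_span_finset_card_eq_spanFinrank fg
  -- lift the generators
  let l : R ⧸ I → R := Function.surjInv Ideal.Quotient.mk_surjective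
  have hl : ∀ w, Ideal.Quotient.mk I (l w) = w := Function.surjInv_eq Ideal.Quotient.mk_surjective
  let t' : Finset R := t.image l
  have hker : RingHom.ker (Ideal.Quotient.mk I) = I := Ideal.mk_ker
  have himg : (Ideal.Quotient.mk I) '' (t' : Set R) = (t : Set (R ⧸ I)) := by
    simp only [t', Finset.coe_image, ← Set.image_comp]
    have : (Ideal.Quotient.mk I) ∘ l = id := funext hl
    rw [this, Set.image_id]
  have hmap : m.map (Ideal.Quotient.mk I) =
      (Ideal.span (t' : Set R)).map (Ideal.Quotient.mk I) := by
    rw [Ideal.map_span, himg, ← htspan]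
  -- `m ≤ (t') + I`
  have h1 : m ≤ Ideal.span (t' : Set R) ⊔ I := by
    intro y hy
    have hy' : Ideal.Quotient.mk I y ∈ m.map (Ideal.Quotient.mk I) := Ideal.mem_map_of_mem _ hy
    rw [hmap, ← Ideal.mem_comap, Ideal.comap_map_of_surjective _ Ideal.Quotient.mk_surjective,
      ← RingHom.ker_eq_comap_bot, hker] at hy'
    exact hy'
  -- `(t') ≤ m`
  have h2 : Ideal.span (t' : Set R) ≤ m := by
    rw [Ideal.span_le]
    intro y hy
    simp only [Finset.coe_image, Set.mem_image, Finset.mem_coe, t'] at hy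
    obtain ⟨w, hw, rfl⟩ := hy
    have : Ideal.Quotient.mk I (l w) ∈ m.map (Ideal.Quotient.mk I) := by
      rw [hl, ← htspan]; exact Submodule.subset_span hw
    rw [← Ideal.mem_comap, Ideal.comap_map_of_surjective _ Ideal.Quotient.mk_surjective,
      ← RingHom.ker_eq_comap_bot, hker, sup_eq_left.mpr hIm] at this
    exact this
  -- Nakayama: `m ≤ (t') + m • m` forces `m ≤ (t')`
  have h3 : m ≤ Ideal.span (t' : Set R) ⊔ m • m := by
    refine h1.trans (sup_le_sup_left ?_ _)
    rw [Ideal.smul_eq_mul, ← pow_two]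
    exact hI
  have h4 : m ≤ Ideal.span (t' : Set R) :=
    Submodule.le_of_le_smul_of_le_jacobson_bot ((isNoetherian_def.mp inferInstance) _)
      (maximalIdeal_le_jacobson ⊥) h3
  have hspan : m = Ideal.span (t' : Set R) := le_antisymm h4 h2
  calc m.spanFinrank = (Ideal.span (t' : Set R)).spanFinrank := by rw [← hspan]
    _ ≤ (t' : Set R).ncard := Submodule.spanFinrank_span_le_ncard_of_finite t'.finite_toSet
    _ ≤ t.card := by
        rw [Set.ncard_coe_finset]
        exact Finset.card_image_le
    _ = _ := htcard

/-- **A regular local ring modulo a non-zero element of `𝔪²` is not regular.** If `(R, 𝔪)` is a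
regular local ring and `0 ≠ x ∈ 𝔪²`, then `R/(x)` is not a regular local ring: `R` is a domain
(Matsumura 14.3), so `x` is a non-zero-divisor and `dim R/(x) + 1 = dim R = μ(𝔪)`; but
`μ(𝔪/(x)) ≥ μ(𝔪)` (Nakayama, `x ∈ 𝔪²`), so `μ(𝔪/(x)) > dim R/(x)`.
[cite: Matsumura1987, Thm. 14.3] -/
theorem not_isRegularLocalRing_quotient_of_mem_sq [IsRegularLocalRing R] {x : R}
    (hx2 : x ∈ (maximalIdeal R) ^ 2) (hx0 : x ≠ 0) :
    ¬ IsRegularLocalRing (R ⧸ Ideal.span {x}) := by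
  intro hQ
  haveI := isDomain_of_isRegularLocalRing R
  have hx : x ∈ maximalIdeal R := Ideal.pow_le_self two_ne_zero hx2
  haveI : Nontrivial (R ⧸ Ideal.span {x}) :=
    Ideal.Quotient.nontrivial_iff.mpr (Ideal.span_singleton_ne_top hx)
  -- `dim R/(x) + 1 = dim R`
  have hdim := ringKrullDim_quotient_span_singleton_succ_eq_ringKrullDim_of_mem_nonZeroDivisors
    (mem_nonZeroDivisors_of_ne_zero hx0) hx
  have hregR := (isRegularLocalRing_iff R).mp ‹_›
  have hregQ := (isRegularLocalRing_iff (R ⧸ Ideal.span {x})).mp hQ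
  -- `μ(𝔪) ≤ μ(𝔪/(x))`
  have hμ := spanFinrank_maximalIdeal_le_spanFinrank_map_of_le_sq (R := R) (I := Ideal.span {x})
    ((Ideal.span_singleton_le_iff_mem _).mpr hx2)
  rw [← maximalIdeal_quotient_eq_map (Ideal.span {x})] at hμ
  obtain ⟨n, hn⟩ := exists_nat_cast_eq_ringKrullDim (R := R ⧸ Ideal.span {x})
  rw [hn] at hdim hregQ
  rw [← hdim] at hregR
  have h1 : (maximalIdeal (R ⧸ Ideal.span {x})).spanFinrank = n := by exact_mod_cast hregQ
  have h2 : (maximalIdeal R).spanFinrank = n + 1 := by exact_mod_cast hregR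
  omega

end AbstractCore

section Origin

variable (k : Type) [Field k]

/-- The ideal `(Xᵢ)ᵢ` of all the variables of `k[Xᵢ : i ∈ σ]` is the kernel of the
constant-coefficient map. [folklore] -/
theorem span_range_X_eq_ker_constantCoeff (σ : Type) :
    Ideal.span (Set.range (X : σ → MvPolynomial σ k)) =
      RingHom.ker (constantCoeff : MvPolynomial σ k →+* k) := by
  apply le_antisymm
  · rw [Ideal.span_le]
    rintro _ ⟨i, rfl⟩
    rw [SetLike.mem_coe, RingHom.mem_ker, constantCoeff_X]
  · intro h hh
    rw [RingHom.mem_ker] at hh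
    rw [← Set.image_univ, mem_ideal_span_X_image]
    intro m hm
    by_contra hne
    push Not at hne
    have hm0 : m = 0 := Finsupp.ext fun i => hne i (Set.mem_univ i)
    rw [hm0, mem_support_iff, ← constantCoeff_eq, hh] at hm
    exact hm rfl

/-- The origin `(Xᵢ)ᵢ` is a maximal ideal of `k[Xᵢ : i ∈ σ]` (`k` a field). [folklore] -/
theorem isMaximal_span_range_X (σ : Type) :
    (Ideal.span (Set.range (X : σ → MvPolynomial σ k))).IsMaximal := by
  rw [span_range_X_eq_ker_constantCoeff]
  exact RingHom.ker_isMaximal_of_surjective _ fun a => ⟨C a, constantCoeff_C _ a⟩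

variable (n : ℕ)

/-- `g = yz + f` lies in the square of the origin `M₀ = (y, z, x₁, …, xₙ)` of
`k[y, z, x₁, …, xₙ]` as soon as `f ∈ (x₁, …, xₙ)²`. [folklore] -/
theorem suspension_mem_sq (f : MvPolynomial (Fin n) k)
    (hf2 : f ∈ (Ideal.span (Set.range X) : Ideal (MvPolynomial (Fin n) k)) ^ 2) :
    (X (Sum.inl 0) * X (Sum.inl 1) + rename Sum.inr f : MvPolynomial (Fin 2 ⊕ Fin n) k) ∈
      (Ideal.span (Set.range X) : Ideal (MvPolynomial (Fin 2 ⊕ Fin n) k)) ^ 2 := by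
  set M₀ : Ideal (MvPolynomial (Fin 2 ⊕ Fin n) k) := Ideal.span (Set.range X) with hM₀
  have hX : ∀ i, (X i : MvPolynomial (Fin 2 ⊕ Fin n) k) ∈ M₀ := fun i => Ideal.subset_span ⟨i, rfl⟩
  refine Ideal.add_mem _ ?_ ?_
  · rw [pow_two]
    exact Ideal.mul_mem_mul (hX _) (hX _)
  · have h1 : (Ideal.span (Set.range X) : Ideal (MvPolynomial (Fin n) k)).map
        (rename (Sum.inr : Fin n → Fin 2 ⊕ Fin n) :
          MvPolynomial (Fin n) k →ₐ[k] MvPolynomial (Fin 2 ⊕ Fin n) k) ≤ M₀ := by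
      rw [Ideal.map_span, Ideal.span_le]
      rintro _ ⟨_, ⟨i, rfl⟩, rfl⟩
      rw [SetLike.mem_coe, rename_X]
      exact hX _
    have h2 := Ideal.mem_map_of_mem
      (rename (Sum.inr : Fin n → Fin 2 ⊕ Fin n) :
        MvPolynomial (Fin n) k →ₐ[k] MvPolynomial (Fin 2 ⊕ Fin n) k) hf2
    rw [Ideal.map_pow] at h2
    exact Ideal.pow_right_mono h1 2 h2

/-- `g = yz + f ≠ 0` when `f` has no constant term: its value at `y = z = 1`, `x = 0` is `1`.
[folklore] -/
theorem suspension_ne_zero (f : MvPolynomial (Fin n) k) (hf : constantCoeff f = 0) :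
    (X (Sum.inl 0) * X (Sum.inl 1) + rename Sum.inr f : MvPolynomial (Fin 2 ⊕ Fin n) k) ≠ 0 := by
  intro h
  have h1 := congrArg (eval (Sum.elim (fun _ => (1 : k)) (fun _ => (0 : k)))) h
  rw [map_add, map_mul, eval_X, eval_X, eval_rename, map_zero, Sum.elim_inl, Sum.elim_inl,
    Sum.elim_comp_inr, eval_zero'] at h1
  rw [hf, mul_one, add_zero] at h1
  exact one_ne_zero h1

end Origin

/-- **The suspension `yz + f = 0` is singular at the origin when `f ∈ (x)²`** (stub W7 of line
`Sketch`, crux stmt-ResolutionOfSingularities-15317). In `S = k[y, z, x₁..xₙ] =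
MvPolynomial (Fin 2 ⊕ Fin n) k` the origin `M = (all variables)` is maximal, `g = yz + f ∈ M²`
(as `f ∈ (x)²`), `g ≠ 0`, `S_M` is regular local (Mathlib instance), and a regular local ring modulo
a NON-ZERO element of `𝔪²` is never regular (`not_isRegularLocalRing_quotient_of_mem_sq`:
`μ(𝔪/(g)) = μ(𝔪)` by Nakayama while `dim S_M/(g) + 1 = dim S_M = μ(𝔪)`).
[cite: Matsumura1987, Thm. 14.3] -/
theorem stub_suspension_not_regular (k : Type) [Field k] (n : ℕ) (f : MvPolynomial (Fin n) k)
    (hf0 : f ≠ 0)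
    (hf2 : f ∈ (Ideal.span (Set.range MvPolynomial.X) : Ideal (MvPolynomial (Fin n) k)) ^ 2) :
    (Ideal.span (Set.range MvPolynomial.X) : Ideal (MvPolynomial (Fin 2 ⊕ Fin n) k)).IsMaximal ∧
    ∀ (M : Ideal (MvPolynomial (Fin 2 ⊕ Fin n) k)) [M.IsMaximal],
      M = Ideal.span (Set.range MvPolynomial.X) →
      (MvPolynomial.X (Sum.inl 0) * MvPolynomial.X (Sum.inl 1) + MvPolynomial.rename Sum.inr f :
        MvPolynomial (Fin 2 ⊕ Fin n) k) ∈ M ∧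
      ¬ IsRegularLocalRing (Localization.AtPrime M ⧸ Ideal.span {algebraMap
        (MvPolynomial (Fin 2 ⊕ Fin n) k) (Localization.AtPrime M)
        (MvPolynomial.X (Sum.inl 0) * MvPolynomial.X (Sum.inl 1) + MvPolynomial.rename Sum.inr f)}) := by
  -- `hf0` is part of the registered signature but not needed: `g = yz + f ≠ 0` for every `f`
  -- without constant term
  have _ : f ≠ 0 := hf0
  refine ⟨isMaximal_span_range_X k (Fin 2 ⊕ Fin n), fun M _ hM => ?_⟩
  set g : MvPolynomial (Fin 2 ⊕ Fin n) k := X (Sum.inl 0) * X (Sum.inl 1) + rename Sum.inr f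
    with hg
  -- `g ∈ M²`
  have hg2 : g ∈ M ^ 2 := by
    rw [hM]
    exact suspension_mem_sq k n f hf2
  have hgM : g ∈ M := Ideal.pow_le_self two_ne_zero hg2
  -- `g ≠ 0`
  have hf : constantCoeff f = 0 := by
    have : f ∈ Ideal.span (Set.range (X : Fin n → MvPolynomial (Fin n) k)) :=
      Ideal.pow_le_self two_ne_zero hf2
    rw [span_range_X_eq_ker_constantCoeff] at this
    exact this
  have hg0 : g ≠ 0 := suspension_ne_zero k n f hf
  refine ⟨hgM, ?_⟩
  -- move to the regular local ring `T = S_M`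
  set T := Localization.AtPrime M with hT
  have hg2' : algebraMap (MvPolynomial (Fin 2 ⊕ Fin n) k) T g ∈ (maximalIdeal T) ^ 2 := by
    rw [← Localization.AtPrime.map_eq_maximalIdeal, ← Ideal.map_pow]
    exact Ideal.mem_map_of_mem _ hg2
  have hg0' : algebraMap (MvPolynomial (Fin 2 ⊕ Fin n) k) T g ≠ 0 := by
    intro h0
    apply hg0
    refine IsLocalization.injective T M.primeCompl_le_nonZeroDivisors ?_
    rw [h0, map_zero]
  exact not_isRegularLocalRing_quotient_of_mem_sq hg2' hg0'

end Summit.ResolutionOfSingularities.ResolutionOfSingularities.Theorems.FRationalResolution
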